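import Mathlib.LinearAlgebra.Matrix.Kronecker
import Mathlib.LinearAlgebra.Matrix.GeneralLinearGroup.Defs
import Mathlib.LinearAlgebra.Matrix.GeneralLinearGroup.Basic
import Mathlib.LinearAlgebra.Matrix.NonsingularInverse
import Mathlib.Topology.Instances.Matrix
import Mathlib.Topology.Algebra.Group.Quotient
import Mathlib.Topology.Algebra.Constructions
import Mathlib.GroupTheory.QuotientGroup.Basic
import Mathlib.GroupTheory.Index
import HarnessLib

/-!
# Clifford–Tate structure: homomorphisms out of a Kronecker frame

Pure (topological) linear algebra.  A multiplicative family `P : Γ → M_{a d}(k)` of Kronecker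
products `P(γ) = X(γ) ⊗ Y(γ)` over a field determines

* a PROJECTIVE representation `σ₂ : Γ → PGL_d(k)`, `γ ↦ [Y(γ)]` (`exists_projectiveFactor`;
  the Kronecker factors are unique up to reciprocal scalars, `exists_smul_eq_of_kronecker_eq`),
  trivial where `P(γ) = X ⊗ 1`;
* given any GENUINE lift `ρ₂ : Γ → GL_d(k)` of `σ₂`, a genuine complementary factor
  `ρ₁ : Γ → GL_a(k)` with `P(γ) = ρ₁(γ) ⊗ ρ₂(γ)` (`exists_leftFactor`), continuous when `P` and `ρ₂`
  are (`continuous_leftFactor`: `ρ₁(γ)_{yx} = ∑_j P(γ)_{(y,l),(x,j)} (ρ₂(γ)⁻¹)_{jl}`).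

Also: a homomorphism trivial on an open subgroup is continuous and, if the subgroup has finite
index, has finite image (`continuous_of_forall_mem_eq_one`, `finite_range_of_forall_mem_eq_one`).
[cite: Clifford1937, Thm. 3] [cite: Zarhin2005Clifford, §3]
-/

set_option autoImplicit false
set_option linter.dupNamespace false

noncomputable section

namespace Summit.Langlands.Langlands.Theorems

open Matrix
open scoped Kronecker MatrixGroups

/-! ### Uniqueness of Kronecker factors -/

section KroneckerUnique

variable {k : Type*} [Field k] {ι κ : Type*}

/-- Kronecker factors are unique up to reciprocal scalars (right factor). [folklore] -/
theorem exists_smul_eq_of_kronecker_eq {X X' : Matrix ι ι k} {Y Y' : Matrix κ κ k}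
    (h : X ⊗ₖ Y = X' ⊗ₖ Y') (h0 : X ⊗ₖ Y ≠ 0) : ∃ c : k, c ≠ 0 ∧ Y = c • Y' := by
  obtain ⟨⟨y, l⟩, ⟨x, j⟩, hne⟩ : ∃ p q, (X ⊗ₖ Y) p q ≠ 0 := by
    by_contra hc
    push Not at hc
    exact h0 (Matrix.ext fun p q => hc p q)
  rw [kroneckerMap_apply] at hne
  have hX : X y x ≠ 0 := left_ne_zero_of_mul hne
  have hX' : X' y x ≠ 0 := by
    have h1 := congrFun (congrFun h (y, l)) (x, j)
    simp only [kroneckerMap_apply] at h1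
    rw [h1] at hne
    exact left_ne_zero_of_mul hne
  refine ⟨X' y x / X y x, div_ne_zero hX' hX, ?_⟩
  ext l' j'
  have h1 := congrFun (congrFun h (y, l')) (x, j')
  simp only [kroneckerMap_apply] at h1
  rw [Matrix.smul_apply, smul_eq_mul]
  field_simp
  rw [mul_comm (Y l' j') (X y x), h1]

/-- Cancellation of a nonzero right Kronecker factor. [folklore] -/
theorem kronecker_left_cancel {X X' : Matrix ι ι k} {Y : Matrix κ κ k} (h : X ⊗ₖ Y = X' ⊗ₖ Y)
    (hY : Y ≠ 0) : X = X' := by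
  obtain ⟨l, j, hne⟩ : ∃ l j, Y l j ≠ 0 := by
    by_contra hc
    push Not at hc
    exact hY (Matrix.ext fun l j => hc l j)
  ext y x
  have h1 := congrFun (congrFun h (y, l)) (x, j)
  simp only [kroneckerMap_apply] at h1
  exact mul_right_cancel₀ hne h1

/-- Cancellation of a nonzero left Kronecker factor. [folklore] -/
theorem kronecker_right_cancel {X : Matrix ι ι k} {Y Y' : Matrix κ κ k} (h : X ⊗ₖ Y = X ⊗ₖ Y')
    (hX : X ≠ 0) : Y = Y' := by
  obtain ⟨y, x, hne⟩ : ∃ y x, X y x ≠ 0 := by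
    by_contra hc
    push Not at hc
    exact hX (Matrix.ext fun y x => hc y x)
  ext l j
  have h1 := congrFun (congrFun h (y, l)) (x, j)
  simp only [kroneckerMap_apply] at h1
  exact mul_left_cancel₀ hne h1

end KroneckerUnique

/-! ### The projective factor -/

section Projective

variable {k : Type*} [Field k] {Γ : Type*} [Group Γ] {a d : ℕ}

/-- A multiplicative family is pointwise invertible. [folklore] -/
theorem isUnit_of_mul_family (P : Γ → Matrix (Fin a × Fin d) (Fin a × Fin d) k)
    (hmul : ∀ γ δ, P (γ * δ) = P γ * P δ) (hone : P 1 = 1) (γ : Γ) : IsUnit (P γ) := by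
  refine ⟨⟨P γ, P γ⁻¹, ?_, ?_⟩, rfl⟩
  · rw [← hmul, mul_inv_cancel, hone]
  · rw [← hmul, inv_mul_cancel, hone]

/-- In a Kronecker factorisation of an invertible matrix (with `a ≠ 0`) the right factor is
invertible. [folklore] -/
theorem isUnit_det_right_of_kronecker (ha : 0 < a) {P : Matrix (Fin a × Fin d) (Fin a × Fin d) k}
    (hP : IsUnit P) {X : Matrix (Fin a) (Fin a) k} {Y : Matrix (Fin d) (Fin d) k}
    (h : P = X ⊗ₖ Y) : IsUnit Y.det := by
  have h1 : IsUnit P.det := (Matrix.isUnit_iff_isUnit_det _).1 hP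
  rw [h, det_kronecker, Fintype.card_fin, Fintype.card_fin] at h1
  rw [isUnit_iff_ne_zero] at h1 ⊢
  intro hY
  apply h1
  rw [hY, zero_pow ha.ne', mul_zero]

/-- **The projective factor.**  For a multiplicative family of Kronecker products
`P(γ) = X(γ) ⊗ Y(γ)` (`a ≠ 0`), `γ ↦ [Y(γ)] ∈ PGL_d(k)` is a well-defined homomorphism, trivial at
every `γ` with `P(γ) = X ⊗ 1`. [cite: Clifford1937, Thm. 3] [cite: Zarhin2005Clifford, §3] -/
theorem exists_projectiveFactor (ha : 0 < a) (hd : 0 < d)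
    (P : Γ → Matrix (Fin a × Fin d) (Fin a × Fin d) k)
    (hmul : ∀ γ δ, P (γ * δ) = P γ * P δ) (hone : P 1 = 1)
    (hP : ∀ γ, ∃ (X : Matrix (Fin a) (Fin a) k) (Y : Matrix (Fin d) (Fin d) k), P γ = X ⊗ₖ Y) :
    ∃ σ₂ : Γ →* GL (Fin d) k ⧸ Subgroup.center (GL (Fin d) k),
      (∀ γ, ∃ (X : Matrix (Fin a) (Fin a) k) (Y : GL (Fin d) k),
        P γ = X ⊗ₖ (Y : Matrix (Fin d) (Fin d) k) ∧ σ₂ γ = QuotientGroup.mk Y) ∧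
      ∀ γ, (∃ X : Matrix (Fin a) (Fin a) k, P γ = X ⊗ₖ (1 : Matrix (Fin d) (Fin d) k)) →
        σ₂ γ = 1 := by
  classical
  haveI : Nonempty (Fin a × Fin d) := ⟨(⟨0, ha⟩, ⟨0, hd⟩)⟩
  choose X Y hXY using hP
  have hunit : ∀ γ, IsUnit (Y γ).det := fun γ =>
    isUnit_det_right_of_kronecker ha (isUnit_of_mul_family P hmul hone γ) (hXY γ)
  have hne : ∀ γ, P γ ≠ 0 := fun γ => (isUnit_of_mul_family P hmul hone γ).ne_zero
  -- the unit `Y(γ)`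
  let U : Γ → GL (Fin d) k := fun γ => (Y γ).nonsingInvUnit (hunit γ)
  have hU : ∀ γ, ((U γ : GL (Fin d) k) : Matrix (Fin d) (Fin d) k) = Y γ := fun γ => rfl
  -- key: two Kronecker factorisations of the same `P γ` give the same class
  have hclass : ∀ (γ : Γ) (X' : Matrix (Fin a) (Fin a) k) (Y' : GL (Fin d) k),
      P γ = X' ⊗ₖ (Y' : Matrix (Fin d) (Fin d) k) →
      (QuotientGroup.mk (U γ) : GL (Fin d) k ⧸ Subgroup.center (GL (Fin d) k)) =
        QuotientGroup.mk Y' := by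
    intro γ X' Y' h'
    have h0 : X γ ⊗ₖ Y γ ≠ 0 := by rw [← hXY γ]; exact hne γ
    obtain ⟨c, hc0, hc⟩ := exists_smul_eq_of_kronecker_eq ((hXY γ).symm.trans h') h0
    apply QuotientGroup.eq.2
    rw [Matrix.GeneralLinearGroup.center_eq_range_scalar]
    refine ⟨(Units.mk0 c hc0)⁻¹, ?_⟩
    rw [eq_inv_mul_iff_mul_eq]
    apply Units.ext
    rw [Units.val_mul, hU, Matrix.GeneralLinearGroup.coe_scalar, hc]
    change (c • (Y' : Matrix (Fin d) (Fin d) k)) * Matrix.scalar (Fin d) ((Units.mk0 c hc0)⁻¹ : kˣ).val = _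
    rw [Matrix.scalar_apply, ← Matrix.smul_eq_mul_diagonal, Units.val_inv_eq_inv_val,
      Units.val_mk0, smul_smul, inv_mul_cancel₀ hc0, one_smul]
  -- the homomorphism
  have hmulU : ∀ γ δ, (QuotientGroup.mk (U (γ * δ)) : GL (Fin d) k ⧸ Subgroup.center (GL (Fin d) k)) =
      QuotientGroup.mk (U γ) * QuotientGroup.mk (U δ) := by
    intro γ δ
    rw [← QuotientGroup.mk_mul]
    apply hclass (γ * δ) (X γ * X δ) (U γ * U δ)
    rw [hmul, hXY γ, hXY δ, ← Matrix.mul_kronecker_mul, Units.val_mul, hU, hU]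
  let σ₂ : Γ →* GL (Fin d) k ⧸ Subgroup.center (GL (Fin d) k) :=
    MonoidHom.mk' (fun γ => QuotientGroup.mk (U γ)) hmulU
  refine ⟨σ₂, fun γ => ⟨X γ, U γ, by rw [hU]; exact hXY γ, rfl⟩, fun γ ⟨X', hX'⟩ => ?_⟩
  change (QuotientGroup.mk (U γ) : GL (Fin d) k ⧸ Subgroup.center (GL (Fin d) k)) = 1
  rw [← QuotientGroup.mk_one]
  exact hclass γ X' 1 (by rw [Units.val_one]; exact hX')

/-- **The complementary factor.**  If `P(γ) = X(γ) ⊗ ρ₂(γ)` for a multiplicative family `P` and a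
GENUINE homomorphism `ρ₂ : Γ → GL_d(k)` (`d ≠ 0`), then the left factors are unique and form a
homomorphism `ρ₁ : Γ → GL_a(k)` with `P = ρ₁ ⊗ ρ₂`. [cite: Clifford1937, Thm. 3] -/
theorem exists_leftFactor (hd : 0 < d) (P : Γ → Matrix (Fin a × Fin d) (Fin a × Fin d) k)
    (hmul : ∀ γ δ, P (γ * δ) = P γ * P δ) (hone : P 1 = 1) (ρ₂ : Γ →* GL (Fin d) k)
    (hP : ∀ γ, ∃ X : Matrix (Fin a) (Fin a) k, P γ = X ⊗ₖ ((ρ₂ γ : GL (Fin d) k) : Matrix _ _ k)) :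
    ∃ ρ₁ : Γ →* GL (Fin a) k, ∀ γ,
      P γ = ((ρ₁ γ : GL (Fin a) k) : Matrix (Fin a) (Fin a) k) ⊗ₖ
        ((ρ₂ γ : GL (Fin d) k) : Matrix (Fin d) (Fin d) k) := by
  classical
  choose X hX using hP
  haveI : Nonempty (Fin d) := ⟨⟨0, hd⟩⟩
  have hρ₂ne : ∀ γ, ((ρ₂ γ : GL (Fin d) k) : Matrix (Fin d) (Fin d) k) ≠ 0 := fun γ h => by
    have h1 := (Matrix.isUnits_det_units (ρ₂ γ)).ne_zero
    rw [h, Matrix.det_zero] at h1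
    exact h1 rfl
  have hXmul : ∀ γ δ, X (γ * δ) = X γ * X δ := by
    intro γ δ
    apply kronecker_left_cancel _ (hρ₂ne (γ * δ))
    rw [← hX, hmul, hX γ, hX δ, ← Matrix.mul_kronecker_mul, ← Units.val_mul, ← map_mul]
  have hXone : X 1 = 1 := by
    apply kronecker_left_cancel _ (hρ₂ne 1)
    rw [← hX, hone, map_one, Units.val_one, Matrix.one_kronecker_one]
  let Xh : Γ →* Matrix (Fin a) (Fin a) k :=
    { toFun := X, map_one' := hXone, map_mul' := hXmul }
  refine ⟨Xh.toHomUnits, fun γ => ?_⟩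
  rw [hX γ]
  rfl

/-- Entry formula for the left factor: `X_{yx} = ∑_j P_{(y,l),(x,j)} (Y⁻¹)_{jl}`. [folklore] -/
theorem leftFactor_apply_eq_sum {P : Matrix (Fin a × Fin d) (Fin a × Fin d) k}
    {X : Matrix (Fin a) (Fin a) k} (Y : GL (Fin d) k)
    (h : P = X ⊗ₖ (Y : Matrix (Fin d) (Fin d) k)) (l : Fin d) (y x : Fin a) :
    X y x = ∑ j, P (y, l) (x, j) * ((Y⁻¹ : GL (Fin d) k) : Matrix (Fin d) (Fin d) k) j l := by
  have h1 : ∀ j, P (y, l) (x, j) = X y x * (Y : Matrix (Fin d) (Fin d) k) l j := fun j => by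
    rw [h, Matrix.kroneckerMap_apply]
  simp_rw [h1, mul_assoc, ← Finset.mul_sum, ← Matrix.mul_apply, ← Units.val_mul, mul_inv_cancel,
    Units.val_one, Matrix.one_apply_eq, mul_one]

/-- **Continuity of the complementary factor.** [folklore] -/
theorem continuous_leftFactor [TopologicalSpace k] [IsTopologicalRing k] [TopologicalSpace Γ]
    [IsTopologicalGroup Γ] (hd : 0 < d) {P : Γ → Matrix (Fin a × Fin d) (Fin a × Fin d) k}
    (hPc : Continuous P) (ρ₁ : Γ →* GL (Fin a) k) (ρ₂ : Γ →* GL (Fin d) k) (hρ₂ : Continuous ρ₂)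
    (h : ∀ γ, P γ = ((ρ₁ γ : GL (Fin a) k) : Matrix (Fin a) (Fin a) k) ⊗ₖ
      ((ρ₂ γ : GL (Fin d) k) : Matrix (Fin d) (Fin d) k)) : Continuous ρ₁ := by
  have hval : Continuous fun γ => ((ρ₁ γ : GL (Fin a) k) : Matrix (Fin a) (Fin a) k) := by
    refine continuous_matrix fun y x => ?_
    have h1 : (fun γ => ((ρ₁ γ : GL (Fin a) k) : Matrix (Fin a) (Fin a) k) y x) = fun γ =>
        ∑ j, P γ (y, ⟨0, hd⟩) (x, j) *
          (((ρ₂ γ)⁻¹ : GL (Fin d) k) : Matrix (Fin d) (Fin d) k) j ⟨0, hd⟩ := by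
      funext γ
      exact leftFactor_apply_eq_sum (ρ₂ γ) (h γ) ⟨0, hd⟩ y x
    rw [h1]
    refine continuous_finsetSum _ fun j _ => ?_
    refine ((hPc.matrix_elem (y, ⟨0, hd⟩) (x, j))).mul ?_
    have h2 : Continuous fun γ => (((ρ₂ γ)⁻¹ : GL (Fin d) k) : Matrix (Fin d) (Fin d) k) :=
      Units.continuous_val.comp (continuous_inv.comp hρ₂)
    exact h2.matrix_elem j ⟨0, hd⟩
  refine Units.continuous_iff.2 ⟨hval, ?_⟩
  have h3 : (fun γ => ((ρ₁ γ)⁻¹ : GL (Fin a) k).val) = fun γ => ((ρ₁ γ⁻¹ : GL (Fin a) k) : Matrix _ _ k) := by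
    funext γ; rw [map_inv]
  rw [h3]
  exact hval.comp continuous_inv

end Projective

/-! ### Homomorphisms trivial on an open subgroup -/

section OpenKernel

variable {Γ : Type*} [Group Γ] [TopologicalSpace Γ] [IsTopologicalGroup Γ]
  {H : Type*} [Group H] [TopologicalSpace H] [IsTopologicalGroup H]

/-- A homomorphism trivial on an open subgroup is continuous. [folklore] -/
theorem continuous_of_forall_mem_eq_one (f : Γ →* H) (N : Subgroup Γ) (hN : IsOpen (N : Set Γ))
    (hf : ∀ n ∈ N, f n = 1) : Continuous f := by
  apply continuous_of_continuousAt_one f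
  rw [ContinuousAt, map_one]
  refine tendsto_const_nhds.congr' ?_
  filter_upwards [hN.mem_nhds (one_mem N)] with n hn
  exact (hf n hn).symm

omit [TopologicalSpace Γ] [IsTopologicalGroup Γ] [TopologicalSpace H] [IsTopologicalGroup H] in
/-- A homomorphism trivial on a subgroup of finite index has finite image. [folklore] -/
theorem finite_range_of_forall_mem_eq_one (f : Γ →* H) (N : Subgroup Γ) [N.FiniteIndex] [N.Normal]
    (hf : ∀ n ∈ N, f n = 1) : (Set.range f).Finite := by
  have hle : N ≤ f.ker := fun n hn => by rw [MonoidHom.mem_ker]; exact hf n hn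
  have h1 : Set.range f = Set.range (QuotientGroup.lift N f hle) := by
    ext h
    constructor
    · rintro ⟨γ, rfl⟩; exact ⟨QuotientGroup.mk γ, by rw [QuotientGroup.lift_mk]⟩
    · rintro ⟨q, rfl⟩
      induction q using QuotientGroup.induction_on with
      | H γ => exact ⟨γ, by rw [QuotientGroup.lift_mk]⟩
  rw [h1]
  haveI : Finite (Γ ⧸ N) := Subgroup.finite_quotient_of_finiteIndex
  exact Set.finite_range _

end OpenKernel

end Summit.Langlands.Langlands.Theorems

end
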